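import Summits.ValiantsHypothesis.ValiantsHypothesis.Theorems.KPlusLogSqLawTropicalGradedWalkDomTGlue1

/-!
# Dominance glue (type T), part 2: block column, rivals above the intended cell

GRW-lite `K = 4` graded-walk family (census side of the tropical root law, all `m`):
dominance glue for the TOP states `(w, w, t)`, `t ≤ w < m` (`w ≥ 1`), of the design typed in
`KPlusLogSqLawTropicalGradedWalkDefs`.  The slack of every rival cell against the row potential `UT`
(file `…PotT`) was certified family by family in `…DomT1` – `…DomT7`; the files `…DomTGlue1` – `…DomTGlue5`
dispatch an arbitrary rival `(a, b, l)` to its family (far rivals are first reduced to the best class of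
their level by the generic lifts of `…GradedWalkLift`) and conclude `IsDominant` via `isDominant_of_scaledPotential`.

Honest framing: this is a census-side (lower-bound) construction — a quadratic family of
distinct optimal slopes for `TropRootLawAt (n+1) 4`.  It says nothing about `TropicalB` inside
its window and nothing about VP ≠ VNP.
-/

set_option linter.dupNamespace false
set_option autoImplicit false

namespace Summit.ValiantsHypothesis.ValiantsHypothesis.Theorems.LacunarySymmetroidMatrixDescartes.TropicalCensus

namespace GradedWalk

open Summit.ValiantsHypothesis.ValiantsHypothesis.Theorems.MatrixDescartes.Negative

variable (n : ℕ)

/-! ### slack, block column, rival above the intended cell (levels above, up to the diagonal) -/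

set_option maxHeartbeats 400000 in
/-- slack of the type-T certificate: block column `b < w`, rival row `b ≤ a < r_b`. -/
theorem slackT_blk_up (w t : ℕ) (htw : t ≤ w) (hwn : w ≤ n) (a b : Fin (n + 1)) (l : Fin 4)
    (hp : ee n a b l ≠ 0) (hbw : (b : ℕ) < w) (hba : (b : ℕ) ≤ (a : ℕ)) (halt : (a : ℕ) < (b : ℕ) + (n + 1 - w)) :
    1 * (thT n w t * (dd n l : ℤ) - vv n a b l) <
      UT n w t a + ((thT n w t * (dd n (lam n w w t b) : ℤ) - vv n (rot n w b) b (lam n w w t b)) - UT n w t (rot n w b)) := by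
  have hw1 : w ≤ n + 1 := by omega
  have hr := rot_val_blk n hw1 b hbw
  have hlowr : (b : ℕ) < ((rot n w b : Fin (n + 1)) : ℕ) := by rw [hr]; omega
  rw [lam_T n w t, if_neg (not_le.mpr hbw)]
  have hEr : n + 1 + (b : ℕ) - ((b : ℕ) + (n + 1 - w)) = w := by omega
  have hwne : w ≠ n + 1 := by omega
  have hT2 : thT n w t * (dd n 2 : ℤ) - vv n (rot n w b) b 2 = thT n w t * d2 n - (v1 n w b + bB n * tau2lt n w b) := by
    rw [dd_cast_two, vv_lower n hlowr, hr, hEr, vblk_two, tau2_of_ne n hwne]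
  have hT3 : thT n w t * (dd n 3 : ℤ) - vv n (rot n w b) b 3 = thT n w t * d3 n - ((v1 n w b + bB n * tau2lt n w b) + tau3lt n w b) := by
    rw [dd_cast_three, vv_lower n hlowr, hr, hEr, vblk_three, tau2_of_ne n hwne, tau3_of_ne n hwne]
  have hUr : UT n w t ((rot n w b : Fin (n + 1)) : ℕ) = gG n * thT n w t * ((((b : ℕ) + (n + 1 - w)) : ℕ) : ℤ) + muT n w t b := by
    rw [hr]; unfold UT; rw [show (b : ℕ) + (n + 1 - w) - (n + 1 - w) = b by omega]
  have hUr' : UT n w t ((rot n w b : Fin (n + 1)) : ℕ) = gG n * thT n w t * (((n + 1 - w + (b : ℕ)) : ℕ) : ℤ) + muT n w t b := by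
    rw [hUr, show (b : ℕ) + (n + 1 - w) = n + 1 - w + (b : ℕ) by omega]
  obtain ⟨k, hk⟩ : ∃ k, (a : ℕ) + k = (b : ℕ) + (n + 1 - w) := ⟨(b : ℕ) + (n + 1 - w) - (a : ℕ), by omega⟩
  have hk1 : 1 ≤ k := by omega
  have hkle : k ≤ (b : ℕ) + (n + 1 - w) := by omega
  have hak : (a : ℕ) = (b : ℕ) + (n + 1 - w) - k := by omega
  rcases Nat.eq_or_lt_of_le hba with hab | hab
  · -- the diagonal cell (b, b): level m
    have hab' : (a : ℕ) = (b : ℕ) := hab.symm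
    have hX1 : thT n w t * (dd n 1 : ℤ) - vv n a b 1 = thT n w t * d1 n - v1 n (n + 1) b := by
      rw [dd_cast_one, vv_diag n hab' 1 (by decide), vblk_one]
    by_cases hcl : l = 0
    · subst hcl
      have hX0 : thT n w t * (dd n 0 : ℤ) - vv n a b 0 = thT n w t * 0 - 0 := by rw [dd_cast_zero, vv_diag_zero n hab']
      have hrow : UT n w t a = UT n w t (b : ℕ) := by rw [hab']
      by_cases ht0 : t = 0
      · subst ht0
        rw [if_neg (Nat.not_lt_zero _)]
        rcases Nat.lt_or_ge (n + 1 - w) (b : ℕ) with hblk | hpl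
        · obtain ⟨jp, hjp⟩ : ∃ jp, (b : ℕ) = (n + 1 - w) + jp := ⟨(b : ℕ) - (n + 1 - w), by omega⟩
          have hY : UT n w 0 a - UT n w 0 ((rot n w b : Fin (n + 1)) : ℕ) = (gG n * thT n w 0 * ((((n + 1 - w) + (jp)) : ℕ) : ℤ) + ST0 n w jp) - (gG n * thT n w 0 * ((((n + 1 - w) + ((n + 1 - w) + jp)) : ℕ) : ℤ) + ST0 n w ((n + 1 - w) + jp)) := by
            rw [hrow, hUr', hjp, muT_z]; unfold UT; rw [show n + 1 - w + jp - (n + 1 - w) = jp by omega, muT_z]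
          have hF := T_dg0_B_zz n w jp (n + 1 - w) (by omega) (by omega) (by omega) (by omega)
          rw [hjp] at hT2
          exact slack_of hF hX0 hT2 hY
        · by_cases hb0 : (b : ℕ) = 0
          · have hY : UT n w 0 a - UT n w 0 ((rot n w b : Fin (n + 1)) : ℕ) = (gG n * thT n w 0 * (((0) : ℕ) : ℤ) + ST0 n w (0)) - (gG n * thT n w 0 * (((n + 1 - w + (0)) : ℕ) : ℤ) + ST0 n w (0)) := by
              rw [hrow, hUr', hb0, muT_z]; unfold UT; rw [Nat.zero_sub, muT_z]
            rw [hb0] at hT2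
            exact slack_of (T_dg0_P_z0 n w (by omega) (by omega)) hX0 hT2 hY
          · have hY : UT n w 0 a - UT n w 0 ((rot n w b : Fin (n + 1)) : ℕ) = gG n * thT n w 0 * (((b : ℕ) : ℕ) : ℤ) - (gG n * thT n w 0 * (((n + 1 - w + (b : ℕ)) : ℕ) : ℤ) + ST0 n w b) := by
              rw [hrow, hUr', muT_z]; unfold UT; rw [show (b : ℕ) - (n + 1 - w) = 0 by omega, muT_zero]; ring
            exact slack_of (T_dg0_P_z n w b (by omega) (by omega) (by omega)) hX0 hT2 hY
      · by_cases hbt : (b : ℕ) < t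
        · rw [if_pos hbt]
          rcases Nat.lt_or_ge (n + 1 - w) (b : ℕ) with hblk | hpl
          · obtain ⟨jp, hjp⟩ : ∃ jp, (b : ℕ) = (n + 1 - w) + jp := ⟨(b : ℕ) - (n + 1 - w), by omega⟩
            have hY : UT n w t a - UT n w t ((rot n w b : Fin (n + 1)) : ℕ) = (gG n * thT n w t * ((((n + 1 - w) + (jp)) : ℕ) : ℤ) + SUB3 n w t jp) - (gG n * thT n w t * ((((n + 1 - w) + ((n + 1 - w) + jp)) : ℕ) : ℤ) + SUB3 n w t ((n + 1 - w) + jp)) := by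
              rw [hrow, hUr', hjp, muT_lt n (by omega)]; unfold UT; rw [show n + 1 - w + jp - (n + 1 - w) = jp by omega, muT_lt n (by omega)]
            have hF := T_dg0_B_ll n w t jp (n + 1 - w) (by omega) (by omega) (by omega) (by omega) (by omega)
            rw [hjp] at hT3
            exact slack_of hF hX0 hT3 hY
          · by_cases hb0 : (b : ℕ) = 0
            · have hY : UT n w t a - UT n w t ((rot n w b : Fin (n + 1)) : ℕ) = (gG n * thT n w t * (((0) : ℕ) : ℤ) + SUB3 n w t (0)) - (gG n * thT n w t * (((n + 1 - w + (0)) : ℕ) : ℤ) + SUB3 n w t (0)) := by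
                rw [hrow, hUr', hb0, muT_lt n (Nat.pos_of_ne_zero ht0)]; unfold UT; rw [Nat.zero_sub, muT_lt n (Nat.pos_of_ne_zero ht0)]
              rw [hb0] at hT3
              exact slack_of (T_dg0_P_l0 n w t (by omega) (by omega) (by omega)) hX0 hT3 hY
            · have hY : UT n w t a - UT n w t ((rot n w b : Fin (n + 1)) : ℕ) = gG n * thT n w t * (((b : ℕ) : ℕ) : ℤ) - (gG n * thT n w t * (((n + 1 - w + (b : ℕ)) : ℕ) : ℤ) + SUB3 n w t b) := by
                rw [hrow, hUr', muT_lt n hbt]; unfold UT; rw [show (b : ℕ) - (n + 1 - w) = 0 by omega, muT_zero]; ring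
              exact slack_of (T_dg0_P_l n w t b (by omega) (by omega) (by omega) (by omega)) hX0 hT3 hY
        · rw [if_neg hbt]
          rcases Nat.lt_or_ge (n + 1 - w) (b : ℕ) with hblk | hpl
          · obtain ⟨jp, hjp⟩ : ∃ jp, (b : ℕ) = (n + 1 - w) + jp := ⟨(b : ℕ) - (n + 1 - w), by omega⟩
            rcases Nat.lt_or_ge jp t with hjt | hjt
            · have hY : UT n w t a - UT n w t ((rot n w b : Fin (n + 1)) : ℕ) = (gG n * thT n w t * ((((n + 1 - w) + (jp)) : ℕ) : ℤ) + SUB3 n w t jp) - (gG n * thT n w t * ((((n + 1 - w) + ((n + 1 - w) + jp)) : ℕ) : ℤ) + STB n w t ((n + 1 - w) + jp)) := by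
                rw [hrow, hUr', hjp, muT_ge n ht0 (by omega)]; unfold UT; rw [show n + 1 - w + jp - (n + 1 - w) = jp by omega, muT_lt n hjt]
              have hF := T_dg0_B_lg n w t jp (n + 1 - w) (by omega) (by omega) (by omega) (by omega) (by omega)
              rw [hjp] at hT2
              exact slack_of hF hX0 hT2 hY
            · have hY : UT n w t a - UT n w t ((rot n w b : Fin (n + 1)) : ℕ) = (gG n * thT n w t * ((((n + 1 - w) + (jp)) : ℕ) : ℤ) + STB n w t jp) - (gG n * thT n w t * ((((n + 1 - w) + ((n + 1 - w) + jp)) : ℕ) : ℤ) + STB n w t ((n + 1 - w) + jp)) := by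
                rw [hrow, hUr', hjp, muT_ge n ht0 (by omega)]; unfold UT; rw [show n + 1 - w + jp - (n + 1 - w) = jp by omega, muT_ge n ht0 (by omega)]
              have hF := T_dg0_B_gg n w t jp (n + 1 - w) (by omega) (by omega) (by omega) (by omega) (by omega)
              rw [hjp] at hT2
              exact slack_of hF hX0 hT2 hY
          · have hY : UT n w t a - UT n w t ((rot n w b : Fin (n + 1)) : ℕ) = gG n * thT n w t * (((b : ℕ) : ℕ) : ℤ) - (gG n * thT n w t * (((n + 1 - w + (b : ℕ)) : ℕ) : ℤ) + STB n w t b) := by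
              rw [hrow, hUr', muT_ge n ht0 hbt]; unfold UT; rw [show (b : ℕ) - (n + 1 - w) = 0 by omega, muT_zero]; ring
            exact slack_of (T_dg0_P_g n w t b (by omega) (by omega) (by omega) (by omega)) hX0 hT2 hY
    · have hθ : thT n w t ≤ LL n * ((n : ℤ) + 1) := thT_le_top n htw hwn
      have hXl : thT n w t * (dd n l : ℤ) - vv n a b l + 1 ≤ thT n w t * d1 n - v1 n (n + 1) b + 1 ∨ l = 1 := by
        rcases (show l = 0 ∨ l = 1 ∨ l = 2 ∨ l = 3 by fin_cases l <;> simp) with rfl | rfl | rfl | rfl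
        · exact absurd rfl hcl
        · exact Or.inr rfl
        · left; rw [dd_cast_two, vv_diag n hab' 2 (by decide), vblk_two]
          linarith [lift_fut2_top n (θ := thT n w t) (b : ℕ) hθ]
        · left; rw [dd_cast_three, vv_diag n hab' 3 (by decide), vblk_three]
          linarith [lift_fut3_top n (θ := thT n w t) (b : ℕ) hθ]
      have hXl : thT n w t * (dd n l : ℤ) - vv n a b l ≤ thT n w t * d1 n - v1 n (n + 1) b := by
        rcases hXl with h | rfl
        · linarith
        · exact le_of_eq hX1
      clear hX1
      by_cases ht0 : t = 0
      · subst ht0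
        rw [if_neg (Nat.not_lt_zero _)]
        rcases Nat.lt_or_ge (b : ℕ) k with hkb | hkb
        · have hY : UT n w 0 a - UT n w 0 ((rot n w b : Fin (n + 1)) : ℕ) = gG n * thT n w 0 * (((n + 1 - w + b - k) : ℕ) : ℤ) - (gG n * thT n w 0 * (((n + 1 - w + (b : ℕ)) : ℕ) : ℤ) + ST0 n w b) := by
            rw [hUr', muT_z]; unfold UT; rw [show (a : ℕ) - (n + 1 - w) = 0 by omega, muT_zero, show (a : ℕ) = n + 1 - w + (b : ℕ) - k by omega]; ring
          have hF := T_up_PZ_m n w b k (by omega) (by omega) (by omega)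
          exact slack_le hF hXl hT2 hY
        · have hY : UT n w 0 a - UT n w 0 ((rot n w b : Fin (n + 1)) : ℕ) = (-(gG n * thT n w 0 * ((k : ℕ) : ℤ))) + (ST0 n w (b - k) - ST0 n w b) := by
            rw [hUr, muT_z]; unfold UT; rw [show (a : ℕ) - (n + 1 - w) = (b : ℕ) - k by omega, muT_z, hak]
            push_cast [Nat.cast_sub hkle, Nat.cast_sub hw1]; ring
          have hF := T_up_Z_m n w b k (by omega) (by omega) (by omega) (by omega)
          exact slack_le hF hXl hT2 hY
      · by_cases hbt : (b : ℕ) < t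
        · rw [if_pos hbt]
          by_cases hb0 : (b : ℕ) = 0
          · have hY : UT n w t a - UT n w t ((rot n w b : Fin (n + 1)) : ℕ) = gG n * thT n w t * (((n + 1 - w - k) : ℕ) : ℤ) - gG n * thT n w t * (((n + 1 - w) : ℕ) : ℤ) := by
              rw [hUr', hb0, muT_zero]; unfold UT; rw [show (a : ℕ) - (n + 1 - w) = 0 by omega, muT_zero, show (a : ℕ) = n + 1 - w - k by omega, Nat.add_zero]; ring
            have hF := T_up_PA0_m n w t k (by omega) (by omega) (by omega) (by omega)
            rw [hb0] at hXl hT3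
            exact slack_le hF hXl hT3 hY
          · rcases Nat.lt_or_ge (b : ℕ) k with hkb | hkb
            · have hY : UT n w t a - UT n w t ((rot n w b : Fin (n + 1)) : ℕ) = gG n * thT n w t * (((n + 1 - w + b - k) : ℕ) : ℤ) - (gG n * thT n w t * (((n + 1 - w + (b : ℕ)) : ℕ) : ℤ) + SUB3 n w t b) := by
                rw [hUr', muT_lt n hbt]; unfold UT; rw [show (a : ℕ) - (n + 1 - w) = 0 by omega, muT_zero, show (a : ℕ) = n + 1 - w + (b : ℕ) - k by omega]; ring
              have hF := T_up_PA_m n w t b k (by omega) (by omega) (by omega) (by omega) (by omega)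
              exact slack_le hF hXl hT3 hY
            · have hY : UT n w t a - UT n w t ((rot n w b : Fin (n + 1)) : ℕ) = (-(gG n * thT n w t * ((k : ℕ) : ℤ))) + (SUB3 n w t (b - k) - SUB3 n w t b) := by
                rw [hUr, muT_lt n hbt]; unfold UT; rw [show (a : ℕ) - (n + 1 - w) = (b : ℕ) - k by omega, muT_lt n (by omega), hak]
                push_cast [Nat.cast_sub hkle, Nat.cast_sub hw1]; ring
              have hF := T_up_A_m n w t b k (by omega) (by omega) (by omega) (by omega) (by omega)
              exact slack_le hF hXl hT3 hY
        · rw [if_neg hbt]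
          rcases Nat.lt_or_ge (b : ℕ) (k + 1) with hkb | hkb
          · have hY : UT n w t a - UT n w t ((rot n w b : Fin (n + 1)) : ℕ) = gG n * thT n w t * (((n + 1 - w + b - k) : ℕ) : ℤ) - (gG n * thT n w t * (((n + 1 - w + (b : ℕ)) : ℕ) : ℤ) + STB n w t b) := by
              rw [hUr', muT_ge n ht0 hbt]; unfold UT; rw [show (a : ℕ) - (n + 1 - w) = 0 by omega, muT_zero, show (a : ℕ) = n + 1 - w + (b : ℕ) - k by omega]; ring
            have hF := T_up_PC_m n w t b k (by omega) (by omega) (by omega) (by omega) (by omega)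
            exact slack_le hF hXl hT2 hY
          · rcases Nat.lt_or_ge ((b : ℕ) - k) t with hst | hst
            · obtain ⟨s, hs⟩ : ∃ s, s + k = (b : ℕ) := ⟨(b : ℕ) - k, by omega⟩
              have hY : UT n w t a - UT n w t ((rot n w b : Fin (n + 1)) : ℕ) = (-(gG n * thT n w t * (((b - s) : ℕ) : ℤ))) + (SUB3 n w t s - STB n w t b) := by
                rw [hUr, muT_ge n ht0 hbt]; unfold UT; rw [show (a : ℕ) - (n + 1 - w) = s by omega, muT_lt n (by omega), hak, show (b : ℕ) - s = k by omega]
                push_cast [Nat.cast_sub hkle, Nat.cast_sub hw1]; ring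
              have hF := T_up_C_m n w t b s (by omega) (by omega) (by omega) (by omega)
              exact slack_le hF hXl hT2 hY
            · have hY : UT n w t a - UT n w t ((rot n w b : Fin (n + 1)) : ℕ) = (-(gG n * thT n w t * ((k : ℕ) : ℤ))) + (STB n w t (b - k) - STB n w t b) := by
                rw [hUr, muT_ge n ht0 hbt]; unfold UT; rw [show (a : ℕ) - (n + 1 - w) = (b : ℕ) - k by omega, muT_ge n ht0 (by omega), hak]
                push_cast [Nat.cast_sub hkle, Nat.cast_sub hw1]; ring
              have hF := T_up_E_m n w t b k (by omega) (by omega) (by omega) (by omega) (by omega)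
              exact slack_le hF hXl hT2 hY
  · -- strictly below the diagonal: level w + k < m
    have hEa : n + 1 + (b : ℕ) - (a : ℕ) = w + k := by omega
    have hne1 : w + k ≠ n + 1 := by omega
    have hθ : thT n w t ≤ LL n * ((w + k : ℕ) : ℤ) := thT_le_LE n htw hwn (by omega)
    have hX1 : thT n w t * (dd n 1 : ℤ) - vv n a b 1 = thT n w t * d1 n - v1 n (w + k) b := by
      rw [dd_cast_one, vv_lower n hab, hEa, vblk_one]
    have hcl : l ≠ 0 := fun h0 => by subst h0; exact hp (ee_lower_zero n hab)
    have hXl : thT n w t * (dd n l : ℤ) - vv n a b l + 1 ≤ thT n w t * d1 n - v1 n (w + k) b + 1 ∨ l = 1 := by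
      rcases (show l = 0 ∨ l = 1 ∨ l = 2 ∨ l = 3 by fin_cases l <;> simp) with rfl | rfl | rfl | rfl
      · exact absurd rfl hcl
      · exact Or.inr rfl
      · left; rw [dd_cast_two, vv_lower n hab, hEa, vblk_two, tau2_of_ne n hne1]
        linarith [lift_fut2 n (θ := thT n w t) (E := w + k) (b : ℕ) (by exact_mod_cast hθ)]
      · left; rw [dd_cast_three, vv_lower n hab, hEa, vblk_three, tau2_of_ne n hne1, tau3_of_ne n hne1]
        linarith [lift_fut3 n (θ := thT n w t) (E := w + k) (b : ℕ) (by exact_mod_cast hθ)]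
    have hXl : thT n w t * (dd n l : ℤ) - vv n a b l ≤ thT n w t * d1 n - v1 n (w + k) b := by
      rcases hXl with h | rfl
      · linarith
      · exact le_of_eq hX1
    clear hX1
    by_cases ht0 : t = 0
    · subst ht0
      rw [if_neg (Nat.not_lt_zero _)]
      rcases Nat.lt_or_ge (b : ℕ) k with hkb | hkb
      · have hY : UT n w 0 a - UT n w 0 ((rot n w b : Fin (n + 1)) : ℕ) = gG n * thT n w 0 * (((n + 1 - w + b - k) : ℕ) : ℤ) - (gG n * thT n w 0 * (((n + 1 - w + (b : ℕ)) : ℕ) : ℤ) + ST0 n w b) := by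
          rw [hUr', muT_z]; unfold UT; rw [show (a : ℕ) - (n + 1 - w) = 0 by omega, muT_zero, show (a : ℕ) = n + 1 - w + (b : ℕ) - k by omega]; ring
        have hF := T_up_PZ_lt n w b k (by omega) (by omega) (by omega)
        exact slack_le hF hXl hT2 hY
      · have hY : UT n w 0 a - UT n w 0 ((rot n w b : Fin (n + 1)) : ℕ) = (-(gG n * thT n w 0 * ((k : ℕ) : ℤ))) + (ST0 n w (b - k) - ST0 n w b) := by
          rw [hUr, muT_z]; unfold UT; rw [show (a : ℕ) - (n + 1 - w) = (b : ℕ) - k by omega, muT_z, hak]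
          push_cast [Nat.cast_sub hkle, Nat.cast_sub hw1]; ring
        have hF := T_up_Z_lt n w b k (by omega) (by omega) (by omega) (by omega)
        exact slack_le hF hXl hT2 hY
    · by_cases hbt : (b : ℕ) < t
      · rw [if_pos hbt]
        by_cases hb0 : (b : ℕ) = 0
        · have hY : UT n w t a - UT n w t ((rot n w b : Fin (n + 1)) : ℕ) = gG n * thT n w t * (((n + 1 - w - k) : ℕ) : ℤ) - gG n * thT n w t * (((n + 1 - w) : ℕ) : ℤ) := by
            rw [hUr', hb0, muT_zero]; unfold UT; rw [show (a : ℕ) - (n + 1 - w) = 0 by omega, muT_zero, show (a : ℕ) = n + 1 - w - k by omega, Nat.add_zero]; ring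
          have hF := T_up_PA0_lt n w t k (by omega) (by omega) (by omega) (by omega)
          rw [hb0] at hXl hT3
          exact slack_le hF hXl hT3 hY
        · rcases Nat.lt_or_ge (b : ℕ) k with hkb | hkb
          · have hY : UT n w t a - UT n w t ((rot n w b : Fin (n + 1)) : ℕ) = gG n * thT n w t * (((n + 1 - w + b - k) : ℕ) : ℤ) - (gG n * thT n w t * (((n + 1 - w + (b : ℕ)) : ℕ) : ℤ) + SUB3 n w t b) := by
              rw [hUr', muT_lt n hbt]; unfold UT; rw [show (a : ℕ) - (n + 1 - w) = 0 by omega, muT_zero, show (a : ℕ) = n + 1 - w + (b : ℕ) - k by omega]; ring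
            have hF := T_up_PA_lt n w t b k (by omega) (by omega) (by omega) (by omega) (by omega)
            exact slack_le hF hXl hT3 hY
          · have hY : UT n w t a - UT n w t ((rot n w b : Fin (n + 1)) : ℕ) = (-(gG n * thT n w t * ((k : ℕ) : ℤ))) + (SUB3 n w t (b - k) - SUB3 n w t b) := by
              rw [hUr, muT_lt n hbt]; unfold UT; rw [show (a : ℕ) - (n + 1 - w) = (b : ℕ) - k by omega, muT_lt n (by omega), hak]
              push_cast [Nat.cast_sub hkle, Nat.cast_sub hw1]; ring
            have hF := T_up_A_lt n w t b k (by omega) (by omega) (by omega) (by omega) (by omega)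
            exact slack_le hF hXl hT3 hY
      · rw [if_neg hbt]
        rcases Nat.lt_or_ge (b : ℕ) (k + 1) with hkb | hkb
        · have hY : UT n w t a - UT n w t ((rot n w b : Fin (n + 1)) : ℕ) = gG n * thT n w t * (((n + 1 - w + b - k) : ℕ) : ℤ) - (gG n * thT n w t * (((n + 1 - w + (b : ℕ)) : ℕ) : ℤ) + STB n w t b) := by
            rw [hUr', muT_ge n ht0 hbt]; unfold UT; rw [show (a : ℕ) - (n + 1 - w) = 0 by omega, muT_zero, show (a : ℕ) = n + 1 - w + (b : ℕ) - k by omega]; ring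
          have hF := T_up_PC_lt n w t b k (by omega) (by omega) (by omega) (by omega) (by omega)
          exact slack_le hF hXl hT2 hY
        · rcases Nat.lt_or_ge ((b : ℕ) - k) t with hst | hst
          · obtain ⟨s, hs⟩ : ∃ s, s + k = (b : ℕ) := ⟨(b : ℕ) - k, by omega⟩
            have hY : UT n w t a - UT n w t ((rot n w b : Fin (n + 1)) : ℕ) = (-(gG n * thT n w t * (((b - s) : ℕ) : ℤ))) + (SUB3 n w t s - STB n w t b) := by
              rw [hUr, muT_ge n ht0 hbt]; unfold UT; rw [show (a : ℕ) - (n + 1 - w) = s by omega, muT_lt n (by omega), hak, show (b : ℕ) - s = k by omega]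
              push_cast [Nat.cast_sub hkle, Nat.cast_sub hw1]; ring
            rw [show w + k = w + ((b : ℕ) - s) by omega] at hXl
            have hF := T_up_C_lt n w t b s (by omega) (by omega) (by omega) (by omega)
            exact slack_le hF hXl hT2 hY
          · have hY : UT n w t a - UT n w t ((rot n w b : Fin (n + 1)) : ℕ) = (-(gG n * thT n w t * ((k : ℕ) : ℤ))) + (STB n w t (b - k) - STB n w t b) := by
              rw [hUr, muT_ge n ht0 hbt]; unfold UT; rw [show (a : ℕ) - (n + 1 - w) = (b : ℕ) - k by omega, muT_ge n ht0 (by omega), hak]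
              push_cast [Nat.cast_sub hkle, Nat.cast_sub hw1]; ring
            have hF := T_up_E_lt n w t b k (by omega) (by omega) (by omega) (by omega) (by omega)
            exact slack_le hF hXl hT2 hY

end GradedWalk

end Summit.ValiantsHypothesis.ValiantsHypothesis.Theorems.LacunarySymmetroidMatrixDescartes.TropicalCensus
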